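import Summits.QuantumFields.YangMills.Theorems.FluctuationComparisonRegPrIntLOrganTangentResidualAxialSection
import Summits.QuantumFields.YangMills.Theorems.FluctuationComparisonRegPrIntLOrganTangentModeSectionKnit
import HarnessLib

/-!
# Crux `FluctuationComparisonRegPrIntL` (stmt-QuantumFields-20520, rung R3), PATH-B organ O1, LINE g26-1 «mode_section», repair R-UNIQ (LEAD w3 g24):
# BERGE ON THE GAUGE-FIXED SLICE — the continuous fibre-mode section of MODE∘ from «the fibre maximiser is unique MODULO THE RESIDUAL GAUGE GROUP»

Cell `ym3-torus` (YM ladder rung R3 = continuum `SU(2)` Yang–Mills on the three-torus — a RUNG: NOT d = 4, NOT infinite volume, NOT a mass gap, NOT Clay).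
Width seat `ym3-torus-px19` (gen 18); `--kind proof --supports stmt-QuantumFields-20520 --as helper`, count-neutral; DEFINITION-FREE (0 `def`, 0 `instance`,
0 `notation`, 0 `sorry`, default heartbeats).

THE CUT (LEAD w3 g24, typing note R-UNIQ, ✓`…OrganTangentUniqMaxResidualGauge`).  The knit ✓`…OrganTangentModeSectionKnit.modeSection_of_uniqueFibreMax` (MODE∘ ⟸
UNIQ-MAX∘) asks a POINTWISE-unique fibre maximiser of the reference density `r′`; clause ⑧ makes `r′` gauge invariant and the residual group «`u (emb y) = 1`» moves
every fine configuration while preserving fibre and window — so that letter is EMPTY.  The repaired letter asks uniqueness MODULO the residual group: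

  `hmax′ : ∀ V ∈ window, ∃ Ustar, descend Ustar = V ∧ PlaqSmall (θ′∕2) Ustar ∧ (∀ U over V in the θ′-window, r′ U ≤ r′ Ustar) ∧
           (∀ U over V in the θ′-window, r′ Ustar ≤ r′ U → ∃ u, (∀ y, u (emb y) = 1) ∧ U = u • Ustar)`.

THIS FILE proves MODE∘'s conclusion (VERBATIM that of ✓`modeSection_of_uniqueFibreMax`: a `W`-continuous section `Us` of `descend` over the coarse window, valued
in the half window, maximising `r′` on every small-field fibre) from `hmax′`, the residual invariance of `r′`, and the same per-bond chart letters — by running the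
Berge argument on the AXIAL SLICE `{U | axSec 1 U = U}` of ✓`…OrganTangentResidualAxialSection` (one representative per residual orbit, chosen continuously):
`Us V := axSec 1 (Ustar V)`.
* §1 ★`continuousOn_of_unique_fibreMax_on` — the Berge-type theorem of ✓`…OrganTangentModeSectionTools` with the uniqueness hypothesis asked only for
  competitors INSIDE the closed set `K` (the landed proof uses uniqueness only at cluster points, which lie in `K`); proof = that argument verbatim.
* §2 ★★`modeSection_of_uniqueFibreMax_modResidual` (residual-invariant `r′`) and ★★`modeSection_of_uniqueFibreMax_modResidual_of_gaugeInvariant` (`GaugeInvariant r′`,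
  the clause-⑧ reading via ✓`…OrganTangentWindowGaugeInvariance`).

RESIDUAL EDITION — NOT PRINT'S STATEMENT (LEAD w3 g24 WORD №5 (B), V18-TYPING-SPEC v1.1 §5).  The hypothesis `hmax′` below asks uniqueness of the fibre maximiser
modulo the RESIDUAL group «`u (emb y) = 1`».  Print's sentence is uniqueness modulo the FULL gauge group ([Balaban1985Variational] Thm 1 p. 279: «the unique critical
ORBIT»; spec §5 row text `… → ∃ u, U = GaugeField.gaugeAct u Ustar`).  The two agree at data `V` whose coarse stabiliser `{g | g • V = V}` is central-constant (then
`ū ∈ Stab V` forces `u` to be residual up to a central constant, which acts trivially); at SYMMETRIC data (non-trivial coarse stabiliser, e.g. abelian `V`) the residual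
edition is STRONGER than print, and the full-group edition needs a STABILISER CLAUSE there (the slice maximiser is unique only up to `Stab V`) which this file does not
supply.  So this file is honest hypothesis-form support on the generic stratum; it docks on the full-group row by one more `∃`-weakening where the stabiliser is central.

HONEST FRAMING: topology∕symmetry bookkeeping over hypothesis letters; nothing of Bałaban's analysis is asserted or proved; the repaired one-well letter (R-UNIQ, in
either edition), MODE∘ (as a row), O1, LIN∘, JEN∘, the five registered ∘-stubs of `Lines/semiclassical_s2beta.lean` v11.4 (★★OWNER RULING №36, untouched),
crux 20520 and `YM3TorusSU2` are NOT proved; rung R3 = SU(2) YM₃ on T³ at fixed lattice data — NOT d = 4, NOT infinite volume, NOT a mass gap, NOT Clay; the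
Yang–Mills mass gap is NOT proved by any of this.

References: T. Bałaban, CMP **102** (1985) 255–275 [Balaban1985UV3] ((42)–(44) p.266); CMP **102** (1985) 277–309 [Balaban1985Variational] ((4) p.278, Thm 1 p.279
«unique … orbit»); CMP **99** (1985) 75–102 [Balaban1985RegularSpaces] ((1.19) p.79); CMP **109** (1987) 249–301 [Balaban1987RG1] ((0.4) p.253); C. Berge, Espaces
topologiques (1963) [folklore maximum theorem].
-/

set_option autoImplicit false

noncomputable section

namespace Summit.QuantumFields.YangMills.Theorems.OrganTangentModeSectionOnSlice

open Filter Topology Set Function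
open Literature.MathematicalPhysics.QuantumFieldTheory.Balaban1983to89
open T3ContinuumYM3Torus T3NestedUnitLaws T3UnitLawDensityEML T3UnitScaleTilt T3LevelShift
open Literature.MathematicalPhysics.QuantumFieldTheory.Balaban1983to89.T4TriangularPushforward (IsLocal)
open Literature.MathematicalPhysics.QuantumFieldTheory.Balaban1983to89.BlockAveragingHaarAC (centralBond)
open Literature.MathematicalPhysics.QuantumFieldTheory.Balaban1983to89.T3OrbitAverage
open B10Eq27TorusAxialLog (axialT gaugeActT gaugeActT_eq_gaugeAct)
open B5Eq118OneStroke (iterBlockOf)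
open B15DeterminingSets (embIter)
open Summit.QuantumFields.YangMills.Theorems.OrganTangentFibreMeanTools (continuous_dist1_plaqHol isClosed_setOf_dist1_le)
open Summit.QuantumFields.YangMills.Theorems.OrganTangentTriangularChart (isLocal_descend injective_private continuous_extend_left)
open Summit.QuantumFields.YangMills.BalabanUVNodes.N09DomAltThresholdNull (isOpen_setOf_plaqSmall_SU)
open Summit.QuantumFields.YangMills.Theorems.OrganTangentResidualAxialSection

/-! ## §1 Berge on a slice: uniqueness asked only inside the closed set `K` -/

section Berge

variable {X Y : Type*} [TopologicalSpace X] [TopologicalSpace Y]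

/-- ★ **CONTINUITY OF FIBRE MAXIMISERS UNIQUE WITHIN A CLOSED SLICE.**  `d : X → Y` from a compact space to a Hausdorff space, `O ⊆ X` open with `d` and
`g : X → ℝ` continuous on `O`, `K ⊆ O` closed, `W ⊆ Y`; (LIFT) every `U ∈ O` has a local continuous section of `d` through it; on `W` a selection `Us` with
`Us V ∈ K`, `d (Us V) = V`, `Us V` maximising `g` on the fibre piece `{U ∈ O | d U = V}`, and UNIQUE among the maximisers THAT LIE IN `K`.  Then `Us` is
continuous on `W`.  (✓`…OrganTangentModeSectionTools.continuousOn_of_unique_fibreMax` asks uniqueness on all of `O`; its proof uses it only at cluster points of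
`Us`, which lie in the closed `K` — the same argument, verbatim.) [folklore] -/
theorem continuousOn_of_unique_fibreMax_on [CompactSpace X] [T2Space Y]
    {d : X → Y} {O : Set X} (hO : IsOpen O) (hd : ContinuousOn d O) {g : X → ℝ} (hg : ContinuousOn g O)
    {K : Set X} (hK : IsClosed K) (hKO : K ⊆ O) {W : Set Y}
    (hlift : ∀ U ∈ O, ∃ Φ : Y → X, ContinuousAt Φ (d U) ∧ Φ (d U) = U ∧ ∀ᶠ V' in 𝓝 (d U), d (Φ V') = V')
    (Us : Y → X) (hUsK : ∀ V ∈ W, Us V ∈ K) (hUsd : ∀ V ∈ W, d (Us V) = V)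
    (hmax : ∀ V ∈ W, ∀ U, d U = V → U ∈ O → g U ≤ g (Us V))
    (huniq : ∀ V ∈ W, ∀ U ∈ K, d U = V → g (Us V) ≤ g U → U = Us V) :
    ContinuousOn Us W := by
  intro V₀ hV₀
  -- cluster points of `Us` along `𝓝[W] V₀` are all equal to `Us V₀`
  refine tendsto_nhds_of_unique_mapClusterPt fun x hx => ?_
  have hl : ∀ᶠ V in 𝓝[W] V₀, V ∈ W := self_mem_nhdsWithin
  -- (a) x ∈ K (K closed, Us ∈ K along the filter)
  have hxK : x ∈ K := by
    by_contra hxK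
    have hfr := (mapClusterPt_iff_frequently.mp hx) Kᶜ (hK.isOpen_compl.mem_nhds hxK)
    exact (hfr.and_eventually hl).exists.elim fun V hV => hV.1 (hUsK V hV.2)
  have hxO : x ∈ O := hKO hxK
  -- (b) d x = V₀ (Y Hausdorff; d ∘ Us = id along the filter)
  have hdx : d x = V₀ := by
    by_contra hne
    obtain ⟨A, B, hA, hB, hxA, hVB, hAB⟩ := t2_separation hne
    have h1 : ∃ᶠ V in 𝓝[W] V₀, Us V ∈ d ⁻¹' A :=
      (mapClusterPt_iff_frequently.mp hx) _ ((hd.continuousAt (hO.mem_nhds hxO)).preimage_mem_nhds (hA.mem_nhds hxA))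
    have h2 : ∀ᶠ V in 𝓝[W] V₀, V ∈ B := mem_nhdsWithin_of_mem_nhds (hB.mem_nhds hVB)
    obtain ⟨V, hVA, hVB', hVW⟩ := (h1.and_eventually (h2.and hl)).exists
    have : d (Us V) ∈ A ∩ B := ⟨hVA, by rw [hUsd V hVW]; exact hVB'⟩
    rw [Set.disjoint_iff_inter_eq_empty.mp hAB] at this
    exact this
  -- (c) g x ≥ g U for every competitor U in the fibre piece over V₀
  have hge : ∀ U, d U = V₀ → U ∈ O → g U ≤ g x := by
    intro U hU hUO
    by_contra hlt
    push Not at hlt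
    obtain ⟨Φ, hΦc, hΦU, hΦd⟩ := hlift U hUO
    rw [hU] at hΦc hΦU hΦd
    set ε : ℝ := (g U - g x) / 2 with hε
    have hεpos : 0 < ε := by rw [hε]; linarith
    -- near x, g < g x + ε
    have hgx : ContinuousAt g x := hg.continuousAt (hO.mem_nhds hxO)
    have hN : ∀ᶠ z in 𝓝 x, g z < g x + ε := hgx.eventually (gt_mem_nhds (by linarith))
    -- near V₀ (within W): g (Φ V) > g U − ε, Φ V ∈ O, d (Φ V) = V
    have hgΦ : ContinuousAt (fun V => g (Φ V)) V₀ :=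
      (hg.continuousAt (hO.mem_nhds (by rw [hΦU]; exact hUO))).comp' (by simpa using hΦc)
    have hE1 : ∀ᶠ V in 𝓝 V₀, g U - ε < g (Φ V) := by
      have := hgΦ.eventually (lt_mem_nhds (show g U - ε < g (Φ V₀) by rw [hΦU]; linarith))
      exact this
    have hE2 : ∀ᶠ V in 𝓝 V₀, Φ V ∈ O := hΦc.preimage_mem_nhds (hO.mem_nhds (by rw [hΦU]; exact hUO))
    have hE : ∀ᶠ V in 𝓝[W] V₀, g U - ε < g (Φ V) ∧ Φ V ∈ O ∧ d (Φ V) = V ∧ V ∈ W :=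
      (((hE1.and (hE2.and hΦd)).filter_mono nhdsWithin_le_nhds).and hl).mono fun V h => ⟨h.1.1, h.1.2.1, h.1.2.2, h.2⟩
    have hF : ∃ᶠ V in 𝓝[W] V₀, g (Us V) < g x + ε := (mapClusterPt_iff_frequently.mp hx) _ hN
    obtain ⟨V, hV1, hV2, hV3, hV4, hVW⟩ := (hF.and_eventually hE).exists
    have h3 : g (Φ V) ≤ g (Us V) := hmax V hVW (Φ V) hV4 hV3
    rw [hε] at hV1 hV2
    linarith
  -- (d) uniqueness at V₀, INSIDE `K`
  exact huniq V₀ hV₀ x hxK hdx (hge (Us V₀) (hUsd V₀ hV₀) (hKO (hUsK V₀ hV₀)))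

end Berge

/-! ## §2 MODE∘'s conclusion from uniqueness modulo the residual gauge group, on the axial slice -/

section Knit

/-- ★★ **MODE∘ FROM A FIBRE MAXIMISER UNIQUE MODULO THE RESIDUAL GROUP + THE PER-BOND CHART LETTERS (R-UNIQ knit, RESIDUAL EDITION — stronger than print's full-group
uniqueness at symmetric data, see the header).**  At heights `j, j+1` (`θ′ = θ_{j+1} > 0`):
a density `r′` continuous on the fine window `{PlaqSmall θ′}` and INVARIANT under the residual group «`u (emb y) = 1`» of the one-step averaging; per coarse bond
`c` the one-bond chart data `T c U` (open), `θ c U` (continuous on `T c U`, right inverse on `T c U`) and (SOL) at the full window radius — VERBATIM the letters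
of ✓`modeSection_of_uniqueFibreMax`; and the REPAIRED one-well letter: for every window datum `V`, a `θ′∕2`-small maximiser `Ustar` of `r′` on the `θ′`-small
part of the fibre `{descend = V}`, every other maximiser of which is `u • Ustar` for a residual `u`.  THEN MODE∘'s conclusion at height `j` holds (conclusion of
✓`modeSection_of_uniqueFibreMax` VERBATIM): a `W`-CONTINUOUS section `Us` of `descend` over the coarse window, valued in the half window, maximising `r′` on every
small-field fibre.  The section is `Us V := axSec 1 (Ustar V)` (the comb-axial representative of the maximiser's residual orbit, ✓`…OrganTangentResidualAxialSection`):
it is well defined on orbits (`axSec_gaugeAct_of_residual_one`), lies over `V` (`descend_axSec`), in the half window (`plaqSmall_axSec_iff`), maximises (`r′`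
residual-invariant), and is the UNIQUE maximiser inside the closed axial slice — where §1 runs. [cite: Balaban1985UV3, (42)-(44) p.266; Balaban1985Variational, (4) p.278; Balaban1985RegularSpaces, (1.19) p.79; Balaban1987RG1, (0.4) p.253] -/
theorem modeSection_of_uniqueFibreMax_modResidual
    (F : T3Family) (γ b₀ p₀ : ℝ) (j : ℕ) (hθ : 0 < θBal F.L γ b₀ p₀ (j + 1))
    (r' : GaugeField (F.P (j + 1)) 0 ↥(Matrix.specialUnitaryGroup (Fin 2) ℂ) → ℝ)
    (hr' : ContinuousOn r' {U | PlaqSmall (θBal F.L γ b₀ p₀ (j + 1)) U})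
    (hr'inv : ∀ u : GaugeTransf (F.P (j + 1)) 0 ↥(Matrix.specialUnitaryGroup (Fin 2) ℂ),
      (∀ y : Site (F.P (j + 1)) 1, u (emb y) = 1) → ∀ U, r' (GaugeField.gaugeAct u U) = r' U)
    (hdc : ContinuousOn (descend F ℰp j : GaugeField (F.P (j + 1)) 0 ↥(Matrix.specialUnitaryGroup (Fin 2) ℂ) →
      GaugeField (F.P j) 0 ↥(Matrix.specialUnitaryGroup (Fin 2) ℂ)) {U | PlaqSmall (θBal F.L γ b₀ p₀ (j + 1)) U})
    (T : PBond (F.P j) 0 → GaugeField (F.P (j + 1)) 0 ↥(Matrix.specialUnitaryGroup (Fin 2) ℂ) → Set ↥(Matrix.specialUnitaryGroup (Fin 2) ℂ))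
    (θ : PBond (F.P j) 0 → GaugeField (F.P (j + 1)) 0 ↥(Matrix.specialUnitaryGroup (Fin 2) ℂ) →
      ↥(Matrix.specialUnitaryGroup (Fin 2) ℂ) → ↥(Matrix.specialUnitaryGroup (Fin 2) ℂ))
    (hTo : ∀ c U, IsOpen (T c U))
    (hθc : ∀ c U, ContinuousOn (θ c U) (T c U))
    (hright : ∀ c U, ∀ v ∈ T c U,
      descend F ℰp j (update U (centralBond (bondShift (sitesPerDir_descend F j 0) c)) (θ c U v)) c = v)
    (hsol : ∀ U : GaugeField (F.P (j + 1)) 0 ↥(Matrix.specialUnitaryGroup (Fin 2) ℂ), PlaqSmall (θBal F.L γ b₀ p₀ (j + 1)) U →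
      ∀ c, descend F ℰp j U c ∈ T c U ∧ θ c U (descend F ℰp j U c) = U (centralBond (bondShift (sitesPerDir_descend F j 0) c)))
    (hmax : ∀ V : GaugeField (F.P j) 0 ↥(Matrix.specialUnitaryGroup (Fin 2) ℂ), PlaqSmall (θBal F.L γ b₀ p₀ j) V →
      ∃ Ustar : GaugeField (F.P (j + 1)) 0 ↥(Matrix.specialUnitaryGroup (Fin 2) ℂ),
        descend F ℰp j Ustar = V ∧ PlaqSmall (θBal F.L γ b₀ p₀ (j + 1) / 2) Ustar ∧
        (∀ U, descend F ℰp j U = V → PlaqSmall (θBal F.L γ b₀ p₀ (j + 1)) U → r' U ≤ r' Ustar) ∧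
        (∀ U, descend F ℰp j U = V → PlaqSmall (θBal F.L γ b₀ p₀ (j + 1)) U → r' Ustar ≤ r' U →
          ∃ u : GaugeTransf (F.P (j + 1)) 0 ↥(Matrix.specialUnitaryGroup (Fin 2) ℂ),
            (∀ y : Site (F.P (j + 1)) 1, u (emb y) = 1) ∧ U = GaugeField.gaugeAct u Ustar)) :
    ∃ Us : GaugeField (F.P j) 0 ↥(Matrix.specialUnitaryGroup (Fin 2) ℂ) → GaugeField (F.P (j + 1)) 0 ↥(Matrix.specialUnitaryGroup (Fin 2) ℂ),
      ContinuousOn Us {V | PlaqSmall (θBal F.L γ b₀ p₀ j) V} ∧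
      (∀ V, PlaqSmall (θBal F.L γ b₀ p₀ j) V → descend F ℰp j (Us V) = V ∧ PlaqSmall (θBal F.L γ b₀ p₀ (j + 1) / 2) (Us V) ∧
        ∀ U, descend F ℰp j U = V → PlaqSmall (θBal F.L γ b₀ p₀ (j + 1)) U → r' U ≤ r' (Us V)) := by
  classical
  set θ' : ℝ := θBal F.L γ b₀ p₀ (j + 1) with hθ'
  set θj : ℝ := θBal F.L γ b₀ p₀ j with hθj
  set β : PBond (F.P j) 0 → PBond (F.P (j + 1)) 0 := fun c => centralBond (bondShift (sitesPerDir_descend F j 0) c) with hβ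
  have hβi : Injective β := injective_private F j
  have hloc : IsLocal β (descend F ℰp j : GaugeField (F.P (j + 1)) 0 ↥(Matrix.specialUnitaryGroup (Fin 2) ℂ) →
      GaugeField (F.P j) 0 ↥(Matrix.specialUnitaryGroup (Fin 2) ℂ)) := isLocal_descend F j
  set O : Set (GaugeField (F.P (j + 1)) 0 ↥(Matrix.specialUnitaryGroup (Fin 2) ℂ)) := {U | PlaqSmall θ' U} with hO
  -- the slice: closed half window ∩ comb-axial configurations (relative to the trivial background)
  set K : Set (GaugeField (F.P (j + 1)) 0 ↥(Matrix.specialUnitaryGroup (Fin 2) ℂ)) :=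
    {U | ∀ p, dist1 (GaugeField.plaqHol U p) ≤ θ' / 2} ∩
    {U | gaugeActT (fun x => (axialT (1 : GaugeField (F.P (j + 1)) 0 ↥(Matrix.specialUnitaryGroup (Fin 2) ℂ)) (embIter 1 (iterBlockOf 1 x)) x)⁻¹ *
        axialT U (embIter 1 (iterBlockOf 1 x)) x) U = U} with hK
  set W : Set (GaugeField (F.P j) 0 ↥(Matrix.specialUnitaryGroup (Fin 2) ℂ)) := {V | PlaqSmall θj V} with hW
  have hOopen : IsOpen O := isOpen_setOf_plaqSmall_SU 2 (F.P (j + 1)) 0 θ'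
  have hKc : IsClosed K :=
    (isClosed_setOf_dist1_le (θ' / 2)).inter (isClosed_setOf_axSec_eq (fun x => embIter 1 (iterBlockOf 1 x)) 1)
  have hKO : K ⊆ O := fun U hU p => (hU.1 p).trans_lt (by linarith)
  -- a maximiser per window datum, and its axial representative
  choose! Ustar hUd hUh hUmax hUuniq using hmax
  refine ⟨fun V => gaugeActT (fun x => (axialT (1 : GaugeField (F.P (j + 1)) 0 ↥(Matrix.specialUnitaryGroup (Fin 2) ℂ))
      (embIter 1 (iterBlockOf 1 x)) x)⁻¹ * axialT (Ustar V) (embIter 1 (iterBlockOf 1 x)) x) (Ustar V), ?_, fun V hV => ⟨?_, ?_, ?_⟩⟩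
  rotate_left
  · rw [descend_axSec]; exact hUd V hV
  · exact (plaqSmall_axSec_iff _ _ _ _).2 (hUh V hV)
  · intro U hU hUO
    rw [apply_axSec_of_residualInvariant (k := 1) (one_le_range F j) r' hr'inv]
    exact hUmax V hV U hU hUO
  -- local continuous sections of `descend` through every small fine field: the triangular chart (as in ✓`modeSection_of_uniqueFibreMax`)
  have hlift : ∀ U ∈ O, ∃ Φ : GaugeField (F.P j) 0 ↥(Matrix.specialUnitaryGroup (Fin 2) ℂ) →
      GaugeField (F.P (j + 1)) 0 ↥(Matrix.specialUnitaryGroup (Fin 2) ℂ),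
      ContinuousAt Φ (descend F ℰp j U) ∧ Φ (descend F ℰp j U) = U ∧ ∀ᶠ V' in 𝓝 (descend F ℰp j U), descend F ℰp j (Φ V') = V' := by
    intro U hU
    refine ⟨fun V' => extend β (fun c => θ c U (V' c)) U, ?_, ?_, ?_⟩
    · have hcoord : ∀ c, ContinuousAt (fun V' : GaugeField (F.P j) 0 ↥(Matrix.specialUnitaryGroup (Fin 2) ℂ) => θ c U (V' c))
          (descend F ℰp j U) := fun c => by
        have hev : Continuous fun V' : GaugeField (F.P j) 0 ↥(Matrix.specialUnitaryGroup (Fin 2) ℂ) => V' c := continuous_apply c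
        have h1 : ContinuousAt (θ c U)
            ((fun V' : GaugeField (F.P j) 0 ↥(Matrix.specialUnitaryGroup (Fin 2) ℂ) => V' c) (descend F ℰp j U)) :=
          (hθc c U).continuousAt ((hTo c U).mem_nhds (hsol U hU c).1)
        exact ContinuousAt.comp (f := fun V' : GaugeField (F.P j) 0 ↥(Matrix.specialUnitaryGroup (Fin 2) ℂ) => V' c)
          (x := descend F ℰp j U) h1 hev.continuousAt
      have hg : ContinuousAt (fun V' : GaugeField (F.P j) 0 ↥(Matrix.specialUnitaryGroup (Fin 2) ℂ) =>
          fun c : PBond (F.P j) 0 => θ c U (V' c)) (descend F ℰp j U) := continuousAt_pi.2 hcoord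
      exact (continuous_extend_left hβi U).continuousAt.comp hg
    · funext i
      show extend β (fun c => θ c U (descend F ℰp j U c)) U i = U i
      by_cases hi : ∃ c, β c = i
      · obtain ⟨c, rfl⟩ := hi
        rw [hβi.extend_apply]
        exact (hsol U hU c).2
      · exact extend_apply' _ _ _ hi
    · have hopen : IsOpen {V' : GaugeField (F.P j) 0 ↥(Matrix.specialUnitaryGroup (Fin 2) ℂ) | ∀ c, V' c ∈ T c U} := by
        rw [show {V' : GaugeField (F.P j) 0 ↥(Matrix.specialUnitaryGroup (Fin 2) ℂ) | ∀ c, V' c ∈ T c U} =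
          ⋂ c, (fun V' => V' c) ⁻¹' T c U from by ext V'; simp]
        exact isOpen_iInter_of_finite fun c => (hTo c U).preimage (continuous_apply c)
      have hmem : descend F ℰp j U ∈ {V' : GaugeField (F.P j) 0 ↥(Matrix.specialUnitaryGroup (Fin 2) ℂ) | ∀ c, V' c ∈ T c U} :=
        fun c => (hsol U hU c).1
      filter_upwards [hopen.mem_nhds hmem] with V' hV'
      exact T4TriangularFibredChart.apply_triChart_eq_of_forall_mem (β := β) (A := descend F ℰp j) (T := T) (θ := θ) hloc hβi hright hV'
  -- Berge on the slice
  refine continuousOn_of_unique_fibreMax_on hOopen hdc hr' hKc hKO hlift _ (fun V hV => ⟨fun p => ?_, ?_⟩)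
    (fun V hV => ?_) (fun V hV U hU hUO => ?_) (fun V hV U hUK hU hle => ?_)
  · -- `Us V` in the closed half window
    rw [dist1_plaqHol_axSec]; exact (hUh V hV p).le
  · -- `Us V` is axial (idempotence)
    exact axSec_idem (k := 1) (one_le_range F j) 1 (Ustar V)
  · -- `Us V` lies over `V`
    rw [descend_axSec]; exact hUd V hV
  · -- `Us V` maximises
    rw [apply_axSec_of_residualInvariant (k := 1) (one_le_range F j) r' hr'inv]
    exact hUmax V hV U hU hUO
  · -- uniqueness INSIDE the slice: a maximiser in `K` is residual-related to `Ustar V`, hence equals its axial representative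
    rw [apply_axSec_of_residualInvariant (k := 1) (one_le_range F j) r' hr'inv] at hle
    obtain ⟨u, hu, hUeq⟩ := hUuniq V hV U hU (hKO hUK) hle
    have hfix := hUK.2
    rw [← hfix, hUeq, ← gaugeActT_eq_gaugeAct]
    exact axSec_gaugeActT_of_residual (k := 1) (one_le_range F j) 1 (Ustar V) u hu

/-- ★★ **The same with `r′` GAUGE INVARIANT** (the clause-⑧ reading: ✓`…OrganTangentWindowGaugeInvariance.gaugeInvariant_of_exists_memAtHeight_exp_mul` makes the reference
density gauge invariant under the full fine gauge group, a fortiori under the residual one). [cite: Balaban1985Averaging, (12)-(13) p.19; Balaban1985UV3, (42)-(44) p.266] -/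
theorem modeSection_of_uniqueFibreMax_modResidual_of_gaugeInvariant
    (F : T3Family) (γ b₀ p₀ : ℝ) (j : ℕ) (hθ : 0 < θBal F.L γ b₀ p₀ (j + 1))
    (r' : GaugeField (F.P (j + 1)) 0 ↥(Matrix.specialUnitaryGroup (Fin 2) ℂ) → ℝ)
    (hr' : ContinuousOn r' {U | PlaqSmall (θBal F.L γ b₀ p₀ (j + 1)) U})
    (hr'inv : GaugeField.GaugeInvariant r')
    (hdc : ContinuousOn (descend F ℰp j : GaugeField (F.P (j + 1)) 0 ↥(Matrix.specialUnitaryGroup (Fin 2) ℂ) →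
      GaugeField (F.P j) 0 ↥(Matrix.specialUnitaryGroup (Fin 2) ℂ)) {U | PlaqSmall (θBal F.L γ b₀ p₀ (j + 1)) U})
    (T : PBond (F.P j) 0 → GaugeField (F.P (j + 1)) 0 ↥(Matrix.specialUnitaryGroup (Fin 2) ℂ) → Set ↥(Matrix.specialUnitaryGroup (Fin 2) ℂ))
    (θ : PBond (F.P j) 0 → GaugeField (F.P (j + 1)) 0 ↥(Matrix.specialUnitaryGroup (Fin 2) ℂ) →
      ↥(Matrix.specialUnitaryGroup (Fin 2) ℂ) → ↥(Matrix.specialUnitaryGroup (Fin 2) ℂ))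
    (hTo : ∀ c U, IsOpen (T c U))
    (hθc : ∀ c U, ContinuousOn (θ c U) (T c U))
    (hright : ∀ c U, ∀ v ∈ T c U,
      descend F ℰp j (update U (centralBond (bondShift (sitesPerDir_descend F j 0) c)) (θ c U v)) c = v)
    (hsol : ∀ U : GaugeField (F.P (j + 1)) 0 ↥(Matrix.specialUnitaryGroup (Fin 2) ℂ), PlaqSmall (θBal F.L γ b₀ p₀ (j + 1)) U →
      ∀ c, descend F ℰp j U c ∈ T c U ∧ θ c U (descend F ℰp j U c) = U (centralBond (bondShift (sitesPerDir_descend F j 0) c)))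
    (hmax : ∀ V : GaugeField (F.P j) 0 ↥(Matrix.specialUnitaryGroup (Fin 2) ℂ), PlaqSmall (θBal F.L γ b₀ p₀ j) V →
      ∃ Ustar : GaugeField (F.P (j + 1)) 0 ↥(Matrix.specialUnitaryGroup (Fin 2) ℂ),
        descend F ℰp j Ustar = V ∧ PlaqSmall (θBal F.L γ b₀ p₀ (j + 1) / 2) Ustar ∧
        (∀ U, descend F ℰp j U = V → PlaqSmall (θBal F.L γ b₀ p₀ (j + 1)) U → r' U ≤ r' Ustar) ∧
        (∀ U, descend F ℰp j U = V → PlaqSmall (θBal F.L γ b₀ p₀ (j + 1)) U → r' Ustar ≤ r' U →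
          ∃ u : GaugeTransf (F.P (j + 1)) 0 ↥(Matrix.specialUnitaryGroup (Fin 2) ℂ),
            (∀ y : Site (F.P (j + 1)) 1, u (emb y) = 1) ∧ U = GaugeField.gaugeAct u Ustar)) :
    ∃ Us : GaugeField (F.P j) 0 ↥(Matrix.specialUnitaryGroup (Fin 2) ℂ) → GaugeField (F.P (j + 1)) 0 ↥(Matrix.specialUnitaryGroup (Fin 2) ℂ),
      ContinuousOn Us {V | PlaqSmall (θBal F.L γ b₀ p₀ j) V} ∧
      (∀ V, PlaqSmall (θBal F.L γ b₀ p₀ j) V → descend F ℰp j (Us V) = V ∧ PlaqSmall (θBal F.L γ b₀ p₀ (j + 1) / 2) (Us V) ∧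
        ∀ U, descend F ℰp j U = V → PlaqSmall (θBal F.L γ b₀ p₀ (j + 1)) U → r' U ≤ r' (Us V)) :=
  modeSection_of_uniqueFibreMax_modResidual F γ b₀ p₀ j hθ r' hr' (fun u _ U => hr'inv u U) hdc T θ hTo hθc hright hsol hmax

end Knit

end Summit.QuantumFields.YangMills.Theorems.OrganTangentModeSectionOnSlice

end
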